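import Summits.QuantumFields.QCD.Theorems.ExtinctionBuildsQCD.Negative.CoercivityCeiling

/-!
# `ExtinctionBuildsQCD` (crux stmt-QuantumFields-18064; filed 8968/17572) — negative-side support:
# the TWO-SIDED PIN at the flavour mass (what TIGHT ∧ EXTINCT hand a bridge prover)

Extract of §6e of the standing disprover's work file (`Cruxes/ExtinctionBuildsQCD/DisproofBase.lean`,
cdisprove cycle 3, 2026-08-16; landed by the 2026-08-17 seat on the restated crux), on top of
`Negative/CoercivityCeiling.lean` (`extinctRatio`, `tightRatio`, `c ≤ 1`), `Negative/WeylWindow.lean`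
(Weyl window budget), `Negative/IndexBudget.lean` (index jumps = real modes) and `Negative/ExtinctIntegrable.lean`.
Statements are about the FILED clauses `Extinct`/`Tight`; since SD⁺ ⇒ SD
(`WithoutTightPlusCollapse.sdHyp_of_sdPlusHyp`) they apply verbatim to witnesses of the restated hypothesis,
and the EXTENSIVE upgrade (floor `max 1 (η (a_k(2L_k+1))²)` of TIGHT⁺) is `Negative/ExtensivePin.lean`.

* `windowRatio`, `bandRatio`, `shellRatio` — phase-quenched means on a torus of `#{λ(Γ₅D_W(U,m_f(k),1)) :
  |λ| ≤ a_k(m_f+M)/Z_k}`, `#{real λ(D_W(U,0,1)) ∈ [−m_f(k), −m_crit(k)+a_kM/Z_k]}`,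
  `#{λ(Γ₅D_W(U,m_f(k),1)) : c a_k m_f/Z_k ≤ |λ| ≤ a_k(m_f+M)/Z_k}`.
* Pointwise: TIGHT's integrand `≤` window/band/shell count `+` EXTINCT integrand
  (`tightIntegrand_mul_le_{window,band,shell}_add_extinct_mul`); in ratios
  `tightRatio ≤ {window,band,shell}Ratio + extinctRatio`.
* **`eventually_{window,band,shell}Ratio_ge`**: for witness data EXTINCT ∧ TIGHT at a tuple above `M₀ ≥ 0`, every
  flavour, `M > M₀`, `ε > 0`: eventually the three means are `≥ 1 − ε` on the scheme torus; `seaShellPin` (card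
  `weyl-transport-unitary-pin`'s stub, stronger constant); `SDHyp.two_sided_pin`.  MEANING: the witness's line is
  CRITICAL — the Hermitian Wilson operator at the flavour (unitary) mass has, on average, a near-zero mode at scale
  exactly `a_k m_f/Z_k` (factor `[c, 1 + M₀/m_f]`), and the massless Wilson operator a real mode in the band at the
  line, while EXTINCT empties the inner collar and everything below `−m_f(k)`.
References: Vafa–Witten, Nucl. Phys. B 234 (1984) 173; Giusti–Lüscher, JHEP 03 (2009) 013 (mode number);
Del Debbio–Giusti–Lüscher–Petronzio–Tantalo, JHEP 02 (2006) 011.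
-/

noncomputable section

namespace Summit.QuantumFields.QCD.Theorems.ExtinctionBuildsQCD.Negative

open scoped BigOperators Topology Classical MeasureTheory Matrix ComplexConjugate
open Filter MeasureTheory Matrix
open Literature.MathematicalPhysics.QuantumLattice Literature.MathematicalPhysics.QuantumFieldTheory
  Literature.Probability.LatticeModels
open Summit.QuantumFields.QCD.Theses.SpectralDefectExtinction

/-! ## §6e What TIGHT ∧ EXTINCT buy, in both currencies: the two-sided pin at the flavour mass -/

section Pin

variable {Nf : ℕ}

/-- One flavour's defect counts (sign + coercivity) are at most the EXTINCT integrand (flavour sum of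
non-negative counts). -/
theorem flavourDefects_le_extinctSum {L : ℕ} [NeZero L] (U : GaugeConfig 4 L SU3) (reg : QCDRegularisation Nf)
    (c : ℝ) (k : ℕ) (m : Fin Nf → ℝ) (f₀ : Fin Nf) :
    (Multiset.countP (fun z : ℂ => z.im = 0 ∧ z.re < -(reg.mcrit k + reg.a k * m f₀ / reg.Zm k)) (wilsonDirac (fundamentalRep (Fin 3)) U 0 1).charpoly.roots : ℝ) + (Multiset.countP (fun z : ℂ => |z.re| < c * (reg.a k * m f₀ / reg.Zm k)) (spinorLift gammaFive * wilsonDirac (fundamentalRep (Fin 3)) U (reg.mcrit k + reg.a k * m f₀ / reg.Zm k) 1).charpoly.roots : ℝ) ≤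
      ∑ f : Fin Nf, ((Multiset.countP (fun z : ℂ => z.im = 0 ∧ z.re < -(reg.mcrit k + reg.a k * m f / reg.Zm k)) (wilsonDirac (fundamentalRep (Fin 3)) U 0 1).charpoly.roots : ℝ) + (Multiset.countP (fun z : ℂ => |z.re| < c * (reg.a k * m f / reg.Zm k)) (spinorLift gammaFive * wilsonDirac (fundamentalRep (Fin 3)) U (reg.mcrit k + reg.a k * m f / reg.Zm k) 1).charpoly.roots : ℝ)) :=
  Finset.single_le_sum (f := fun f : Fin Nf => ((Multiset.countP (fun z : ℂ => z.im = 0 ∧ z.re < -(reg.mcrit k + reg.a k * m f / reg.Zm k)) (wilsonDirac (fundamentalRep (Fin 3)) U 0 1).charpoly.roots : ℝ) + (Multiset.countP (fun z : ℂ => |z.re| < c * (reg.a k * m f / reg.Zm k)) (spinorLift gammaFive * wilsonDirac (fundamentalRep (Fin 3)) U (reg.mcrit k + reg.a k * m f / reg.Zm k) 1).charpoly.roots : ℝ)))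
    (fun _ _ => add_nonneg (Nat.cast_nonneg _) (Nat.cast_nonneg _)) (Finset.mem_univ f₀)

/-- One flavour's sign-defect count is at most the EXTINCT integrand. -/
theorem signDefects_le_extinctSum {L : ℕ} [NeZero L] (U : GaugeConfig 4 L SU3) (reg : QCDRegularisation Nf)
    (c : ℝ) (k : ℕ) (m : Fin Nf → ℝ) (f₀ : Fin Nf) :
    (Multiset.countP (fun z : ℂ => z.im = 0 ∧ z.re < -(reg.mcrit k + reg.a k * m f₀ / reg.Zm k)) (wilsonDirac (fundamentalRep (Fin 3)) U 0 1).charpoly.roots : ℝ) ≤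
      ∑ f : Fin Nf, ((Multiset.countP (fun z : ℂ => z.im = 0 ∧ z.re < -(reg.mcrit k + reg.a k * m f / reg.Zm k)) (wilsonDirac (fundamentalRep (Fin 3)) U 0 1).charpoly.roots : ℝ) + (Multiset.countP (fun z : ℂ => |z.re| < c * (reg.a k * m f / reg.Zm k)) (spinorLift gammaFive * wilsonDirac (fundamentalRep (Fin 3)) U (reg.mcrit k + reg.a k * m f / reg.Zm k) 1).charpoly.roots : ℝ)) :=
  le_trans (le_add_of_nonneg_right (Nat.cast_nonneg _)) (flavourDefects_le_extinctSum U reg c k m f₀)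

/-- `countP p ≤ countP q + countP r` when `p → q ∨ r` (any multiset). -/
theorem countP_le_countP_add_countP {α : Type*} (s : Multiset α) {p q r : α → Prop} [DecidablePred p]
    [DecidablePred q] [DecidablePred r] (h : ∀ x, p x → q x ∨ r x) :
    s.countP p ≤ s.countP q + s.countP r := by
  induction s using Multiset.induction_on with
  | empty => simp
  | cons a s ih =>
    simp only [Multiset.countP_cons]
    by_cases hp : p a
    · rcases h a hp with hq | hr
      · rw [if_pos hp, if_pos hq]; split_ifs <;> omega
      · rw [if_pos hp, if_pos hr]; split_ifs <;> omega
    · rw [if_neg hp]; split_ifs <;> omega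

/-- **Pointwise, Hermitian currency: TIGHT ≤ window at the flavour mass + EXTINCT.** For any witness data,
step `k`, tuple `m`, probe `M ≥ 0` and flavour `f₀` with `m_{f₀} ≥ 0`, on every gauge field of the torus
`(2L'+1)⁴`, weighted by `W = ∏_f |det D_W(U, m_f(k), 1)|`:
`|index(m_crit − w_M)|·W ≤ #{λ(Γ₅D_W(U, m_{f₀}(k), 1)) : |λ| ≤ a_k(m_{f₀}+M)/Z_k}·W + (EXTINCT integrand)·W`. -/
theorem tightIntegrand_mul_le_window_add_extinct_mul {L' : ℕ} (U : GaugeConfig 4 (2 * L' + 1) SU3)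
    (reg : QCDRegularisation Nf) (c : ℝ) (k : ℕ) (m : Fin Nf → ℝ) (M : ℝ) (f₀ : Fin Nf)
    (hm : 0 ≤ m f₀) (hM : 0 ≤ M) :
    |(Multiset.countP (fun z : ℂ => z.re < 0) (spinorLift gammaFive * wilsonDirac (fundamentalRep (Fin 3)) U (reg.mcrit k - reg.a k * M / reg.Zm k) 1).charpoly.roots : ℝ) - 6 * (2 * L' + 1 : ℝ) ^ 4| * ∏ f : Fin Nf, ‖fermionDet (wilsonDirac (fundamentalRep (Fin 3)) U (reg.mcrit k + reg.a k * m f / reg.Zm k) 1)‖ ≤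
      (Multiset.countP (fun z : ℂ => |z.re| ≤ reg.a k * m f₀ / reg.Zm k + reg.a k * M / reg.Zm k) (spinorLift gammaFive * wilsonDirac (fundamentalRep (Fin 3)) U (reg.mcrit k + reg.a k * m f₀ / reg.Zm k) 1).charpoly.roots : ℝ) * ∏ f : Fin Nf, ‖fermionDet (wilsonDirac (fundamentalRep (Fin 3)) U (reg.mcrit k + reg.a k * m f / reg.Zm k) 1)‖ +
      (∑ f : Fin Nf, ((Multiset.countP (fun z : ℂ => z.im = 0 ∧ z.re < -(reg.mcrit k + reg.a k * m f / reg.Zm k)) (wilsonDirac (fundamentalRep (Fin 3)) U 0 1).charpoly.roots : ℝ) + (Multiset.countP (fun z : ℂ => |z.re| < c * (reg.a k * m f / reg.Zm k)) (spinorLift gammaFive * wilsonDirac (fundamentalRep (Fin 3)) U (reg.mcrit k + reg.a k * m f / reg.Zm k) 1).charpoly.roots : ℝ))) * ∏ f : Fin Nf, ‖fermionDet (wilsonDirac (fundamentalRep (Fin 3)) U (reg.mcrit k + reg.a k * m f / reg.Zm k) 1)‖ := by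
  have hwf0 : 0 ≤ reg.a k * m f₀ / reg.Zm k := div_nonneg (mul_nonneg (reg.a_pos k).le hm) (reg.Zm_pos k).le
  have hwM0 : 0 ≤ reg.a k * M / reg.Zm k := div_nonneg (mul_nonneg (reg.a_pos k).le hM) (reg.Zm_pos k).le
  refine le_of_le_of_eq ?_ (add_mul _ _ _)
  by_cases hdet : fermionDet (wilsonDirac (fundamentalRep (Fin 3)) U (reg.mcrit k + reg.a k * m f₀ / reg.Zm k) 1) = 0
  · -- a real eigenvalue of `D_W(U,0,1)` exactly at `−m_{f₀}(k)`: the weight vanishes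
    have hWz : (∏ f : Fin Nf, ‖fermionDet (wilsonDirac (fundamentalRep (Fin 3)) U
        (reg.mcrit k + reg.a k * m f / reg.Zm k) 1)‖) = 0 :=
      Finset.prod_eq_zero (Finset.mem_univ f₀) (by rw [hdet, norm_zero])
    rw [hWz, mul_zero, mul_zero]
  · refine mul_le_mul_of_nonneg_right ?_ (Finset.prod_nonneg fun f _ => norm_nonneg _)
    -- no atom: Hermitian-currency budget, cast to `ℝ`
    have hatom : Multiset.countP (fun z : ℂ => z = ((-(reg.mcrit k + reg.a k * m f₀ / reg.Zm k) : ℝ) : ℂ))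
        (wilsonDirac (fundamentalRep (Fin 3)) U 0 1).charpoly.roots = 0 :=
      Multiset.countP_eq_zero.2 fun z hz h => hdet (fermionDet_eq_zero_of_root U _ hz h)
    have hZ := tight_integrand_le_window_add_realModes U (reg.mcrit k) (reg.a k * m f₀ / reg.Zm k)
      (reg.a k * M / reg.Zm k) hwf0 hwM0
    rw [countP_realModes_le_eq U, hatom, add_zero] at hZ
    have hRe : |(Multiset.countP (fun z : ℂ => z.re < 0) (spinorLift gammaFive * wilsonDirac (fundamentalRep (Fin 3)) U (reg.mcrit k - reg.a k * M / reg.Zm k) 1).charpoly.roots : ℝ) - 6 * (2 * L' + 1 : ℝ) ^ 4| ≤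
        (Multiset.countP (fun z : ℂ => |z.re| ≤ reg.a k * m f₀ / reg.Zm k + reg.a k * M / reg.Zm k) (spinorLift gammaFive * wilsonDirac (fundamentalRep (Fin 3)) U (reg.mcrit k + reg.a k * m f₀ / reg.Zm k) 1).charpoly.roots : ℝ) +
          (Multiset.countP (fun z : ℂ => z.im = 0 ∧ z.re < -(reg.mcrit k + reg.a k * m f₀ / reg.Zm k)) (wilsonDirac (fundamentalRep (Fin 3)) U 0 1).charpoly.roots : ℝ) := by
      exact_mod_cast hZ
    have hsum := signDefects_le_extinctSum U reg c k m f₀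
    linarith

/-- **Pointwise, real-mode currency: TIGHT ≤ band at the line + EXTINCT** (`tight_integrand_le_signDefects_add_band`
weighted and with the flavour sum): the band is `[−m_{f₀}(k), −(m_crit(k) − a_kM/Z_k)]`, of bare width
`a_k(m_{f₀}+M)/Z_k` around `−m_crit(k)`. -/
theorem tightIntegrand_mul_le_band_add_extinct_mul {L' : ℕ} (U : GaugeConfig 4 (2 * L' + 1) SU3)
    (reg : QCDRegularisation Nf) (c : ℝ) (k : ℕ) (m : Fin Nf → ℝ) (M : ℝ) (f₀ : Fin Nf)
    (hm : 0 ≤ m f₀) (hM : 0 ≤ M) :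
    |(Multiset.countP (fun z : ℂ => z.re < 0) (spinorLift gammaFive * wilsonDirac (fundamentalRep (Fin 3)) U (reg.mcrit k - reg.a k * M / reg.Zm k) 1).charpoly.roots : ℝ) - 6 * (2 * L' + 1 : ℝ) ^ 4| * ∏ f : Fin Nf, ‖fermionDet (wilsonDirac (fundamentalRep (Fin 3)) U (reg.mcrit k + reg.a k * m f / reg.Zm k) 1)‖ ≤
      (Multiset.countP (fun z : ℂ => z.im = 0 ∧ -(reg.mcrit k + reg.a k * m f₀ / reg.Zm k) ≤ z.re ∧ z.re ≤ -(reg.mcrit k - reg.a k * M / reg.Zm k)) (wilsonDirac (fundamentalRep (Fin 3)) U 0 1).charpoly.roots : ℝ) * ∏ f : Fin Nf, ‖fermionDet (wilsonDirac (fundamentalRep (Fin 3)) U (reg.mcrit k + reg.a k * m f / reg.Zm k) 1)‖ +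
      (∑ f : Fin Nf, ((Multiset.countP (fun z : ℂ => z.im = 0 ∧ z.re < -(reg.mcrit k + reg.a k * m f / reg.Zm k)) (wilsonDirac (fundamentalRep (Fin 3)) U 0 1).charpoly.roots : ℝ) + (Multiset.countP (fun z : ℂ => |z.re| < c * (reg.a k * m f / reg.Zm k)) (spinorLift gammaFive * wilsonDirac (fundamentalRep (Fin 3)) U (reg.mcrit k + reg.a k * m f / reg.Zm k) 1).charpoly.roots : ℝ))) * ∏ f : Fin Nf, ‖fermionDet (wilsonDirac (fundamentalRep (Fin 3)) U (reg.mcrit k + reg.a k * m f / reg.Zm k) 1)‖ := by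
  have hwf0 : 0 ≤ reg.a k * m f₀ / reg.Zm k := div_nonneg (mul_nonneg (reg.a_pos k).le hm) (reg.Zm_pos k).le
  have hwM0 : 0 ≤ reg.a k * M / reg.Zm k := div_nonneg (mul_nonneg (reg.a_pos k).le hM) (reg.Zm_pos k).le
  refine le_of_le_of_eq ?_ (add_mul _ _ _)
  refine mul_le_mul_of_nonneg_right ?_ (Finset.prod_nonneg fun f _ => norm_nonneg _)
  have hZ := tight_integrand_le_signDefects_add_band U (reg.mcrit k) (reg.a k * m f₀ / reg.Zm k)
    (reg.a k * M / reg.Zm k) hwf0 hwM0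
  have hRe : |(Multiset.countP (fun z : ℂ => z.re < 0) (spinorLift gammaFive * wilsonDirac (fundamentalRep (Fin 3)) U (reg.mcrit k - reg.a k * M / reg.Zm k) 1).charpoly.roots : ℝ) - 6 * (2 * L' + 1 : ℝ) ^ 4| ≤
      (Multiset.countP (fun z : ℂ => z.im = 0 ∧ z.re < -(reg.mcrit k + reg.a k * m f₀ / reg.Zm k)) (wilsonDirac (fundamentalRep (Fin 3)) U 0 1).charpoly.roots : ℝ) +
        (Multiset.countP (fun z : ℂ => z.im = 0 ∧ -(reg.mcrit k + reg.a k * m f₀ / reg.Zm k) ≤ z.re ∧ z.re ≤ -(reg.mcrit k - reg.a k * M / reg.Zm k)) (wilsonDirac (fundamentalRep (Fin 3)) U 0 1).charpoly.roots : ℝ) := by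
    exact_mod_cast hZ
  have hsum := signDefects_le_extinctSum U reg c k m f₀
  linarith

/-- **Pointwise, unitary-shell currency: TIGHT ≤ SHELL at the flavour mass + EXTINCT.** The closed window
`|λ| ≤ a_k(m_{f₀}+M)/Z_k` splits into EXTINCT(b)'s open window `|λ| < c·a_k m_{f₀}/Z_k` and the SHELL
`c·a_k m_{f₀}/Z_k ≤ |λ| ≤ a_k(m_{f₀}+M)/Z_k`; the open window and the sign defects of `f₀` are both inside the EXTINCT
integrand, so `|index|·W ≤ #shell·W + (EXTINCT integrand)·W` — EXTINCT is spent ONCE. -/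
theorem tightIntegrand_mul_le_shell_add_extinct_mul {L' : ℕ} (U : GaugeConfig 4 (2 * L' + 1) SU3)
    (reg : QCDRegularisation Nf) (c : ℝ) (k : ℕ) (m : Fin Nf → ℝ) (M : ℝ) (f₀ : Fin Nf)
    (hm : 0 ≤ m f₀) (hM : 0 ≤ M) :
    |(Multiset.countP (fun z : ℂ => z.re < 0) (spinorLift gammaFive * wilsonDirac (fundamentalRep (Fin 3)) U (reg.mcrit k - reg.a k * M / reg.Zm k) 1).charpoly.roots : ℝ) - 6 * (2 * L' + 1 : ℝ) ^ 4| * ∏ f : Fin Nf, ‖fermionDet (wilsonDirac (fundamentalRep (Fin 3)) U (reg.mcrit k + reg.a k * m f / reg.Zm k) 1)‖ ≤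
      (Multiset.countP (fun z : ℂ => c * (reg.a k * m f₀ / reg.Zm k) ≤ |z.re| ∧ |z.re| ≤ reg.a k * m f₀ / reg.Zm k + reg.a k * M / reg.Zm k) (spinorLift gammaFive * wilsonDirac (fundamentalRep (Fin 3)) U (reg.mcrit k + reg.a k * m f₀ / reg.Zm k) 1).charpoly.roots : ℝ) * ∏ f : Fin Nf, ‖fermionDet (wilsonDirac (fundamentalRep (Fin 3)) U (reg.mcrit k + reg.a k * m f / reg.Zm k) 1)‖ +
      (∑ f : Fin Nf, ((Multiset.countP (fun z : ℂ => z.im = 0 ∧ z.re < -(reg.mcrit k + reg.a k * m f / reg.Zm k)) (wilsonDirac (fundamentalRep (Fin 3)) U 0 1).charpoly.roots : ℝ) + (Multiset.countP (fun z : ℂ => |z.re| < c * (reg.a k * m f / reg.Zm k)) (spinorLift gammaFive * wilsonDirac (fundamentalRep (Fin 3)) U (reg.mcrit k + reg.a k * m f / reg.Zm k) 1).charpoly.roots : ℝ))) * ∏ f : Fin Nf, ‖fermionDet (wilsonDirac (fundamentalRep (Fin 3)) U (reg.mcrit k + reg.a k * m f / reg.Zm k) 1)‖ := by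
  have hwf0 : 0 ≤ reg.a k * m f₀ / reg.Zm k := div_nonneg (mul_nonneg (reg.a_pos k).le hm) (reg.Zm_pos k).le
  have hwM0 : 0 ≤ reg.a k * M / reg.Zm k := div_nonneg (mul_nonneg (reg.a_pos k).le hM) (reg.Zm_pos k).le
  refine le_of_le_of_eq ?_ (add_mul _ _ _)
  by_cases hdet : fermionDet (wilsonDirac (fundamentalRep (Fin 3)) U (reg.mcrit k + reg.a k * m f₀ / reg.Zm k) 1) = 0
  · have hWz : (∏ f : Fin Nf, ‖fermionDet (wilsonDirac (fundamentalRep (Fin 3)) U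
        (reg.mcrit k + reg.a k * m f / reg.Zm k) 1)‖) = 0 :=
      Finset.prod_eq_zero (Finset.mem_univ f₀) (by rw [hdet, norm_zero])
    rw [hWz, mul_zero, mul_zero]
  · refine mul_le_mul_of_nonneg_right ?_ (Finset.prod_nonneg fun f _ => norm_nonneg _)
    have hatom : Multiset.countP (fun z : ℂ => z = ((-(reg.mcrit k + reg.a k * m f₀ / reg.Zm k) : ℝ) : ℂ))
        (wilsonDirac (fundamentalRep (Fin 3)) U 0 1).charpoly.roots = 0 :=
      Multiset.countP_eq_zero.2 fun z hz h => hdet (fermionDet_eq_zero_of_root U _ hz h)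
    have hZ := tight_integrand_le_window_add_realModes U (reg.mcrit k) (reg.a k * m f₀ / reg.Zm k)
      (reg.a k * M / reg.Zm k) hwf0 hwM0
    rw [countP_realModes_le_eq U, hatom, add_zero] at hZ
    have hRe : |(Multiset.countP (fun z : ℂ => z.re < 0) (spinorLift gammaFive * wilsonDirac (fundamentalRep (Fin 3)) U (reg.mcrit k - reg.a k * M / reg.Zm k) 1).charpoly.roots : ℝ) - 6 * (2 * L' + 1 : ℝ) ^ 4| ≤
        (Multiset.countP (fun z : ℂ => |z.re| ≤ reg.a k * m f₀ / reg.Zm k + reg.a k * M / reg.Zm k) (spinorLift gammaFive * wilsonDirac (fundamentalRep (Fin 3)) U (reg.mcrit k + reg.a k * m f₀ / reg.Zm k) 1).charpoly.roots : ℝ) +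
          (Multiset.countP (fun z : ℂ => z.im = 0 ∧ z.re < -(reg.mcrit k + reg.a k * m f₀ / reg.Zm k)) (wilsonDirac (fundamentalRep (Fin 3)) U 0 1).charpoly.roots : ℝ) := by
      exact_mod_cast hZ
    have hsplit : (Multiset.countP (fun z : ℂ => |z.re| ≤ reg.a k * m f₀ / reg.Zm k + reg.a k * M / reg.Zm k) (spinorLift gammaFive * wilsonDirac (fundamentalRep (Fin 3)) U (reg.mcrit k + reg.a k * m f₀ / reg.Zm k) 1).charpoly.roots : ℝ) ≤
        (Multiset.countP (fun z : ℂ => c * (reg.a k * m f₀ / reg.Zm k) ≤ |z.re| ∧ |z.re| ≤ reg.a k * m f₀ / reg.Zm k + reg.a k * M / reg.Zm k) (spinorLift gammaFive * wilsonDirac (fundamentalRep (Fin 3)) U (reg.mcrit k + reg.a k * m f₀ / reg.Zm k) 1).charpoly.roots : ℝ) +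
          (Multiset.countP (fun z : ℂ => |z.re| < c * (reg.a k * m f₀ / reg.Zm k)) (spinorLift gammaFive * wilsonDirac (fundamentalRep (Fin 3)) U (reg.mcrit k + reg.a k * m f₀ / reg.Zm k) 1).charpoly.roots : ℝ) := by
      exact_mod_cast countP_le_countP_add_countP _
        (p := fun z : ℂ => |z.re| ≤ reg.a k * m f₀ / reg.Zm k + reg.a k * M / reg.Zm k)
        (q := fun z : ℂ => c * (reg.a k * m f₀ / reg.Zm k) ≤ |z.re| ∧ |z.re| ≤ reg.a k * m f₀ / reg.Zm k + reg.a k * M / reg.Zm k)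
        (r := fun z : ℂ => |z.re| < c * (reg.a k * m f₀ / reg.Zm k))
        fun z hz => (le_or_gt (c * (reg.a k * m f₀ / reg.Zm k)) |z.re|).imp (fun h => ⟨h, hz⟩) id
    have hsum := flavourDefects_le_extinctSum U reg c k m f₀
    linarith

/-- The phase-quenched mean, on the torus of half-side `S` at step `k` of witness data `reg` with tuple `m`,
of the WINDOW count of flavour `f` at probe parameter `M`: `E₊ #{λ(Γ₅D_W(U, m_f(k), 1)) : |λ| ≤ a_k(m_f+M)/Z_k}`. -/
noncomputable def windowRatio (reg : QCDRegularisation Nf) (k S : ℕ) (m : Fin Nf → ℝ) (f : Fin Nf)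
    (M : ℝ) : ℝ :=
  (∫ U, (Multiset.countP (fun z : ℂ => |z.re| ≤ reg.a k * m f / reg.Zm k + reg.a k * M / reg.Zm k) (spinorLift gammaFive * wilsonDirac (fundamentalRep (Fin 3)) U (reg.mcrit k + reg.a k * m f / reg.Zm k) 1).charpoly.roots : ℝ) * ∏ f : Fin Nf, ‖fermionDet (wilsonDirac (fundamentalRep (Fin 3)) U (reg.mcrit k + reg.a k * m f / reg.Zm k) 1)‖ ∂(wilsonMeasure (d := 4) (L := 2 * S + 1) (fundamentalRep (Fin 3)) (reg.β k))) / (∫ U, ∏ f : Fin Nf, ‖fermionDet (wilsonDirac (fundamentalRep (Fin 3)) U (reg.mcrit k + reg.a k * m f / reg.Zm k) 1)‖ ∂(wilsonMeasure (d := 4) (L := 2 * S + 1) (fundamentalRep (Fin 3)) (reg.β k)))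

/-- The phase-quenched mean of the BAND count of flavour `f`:
`E₊ #{real λ(D_W(U,0,1)) ∈ [−m_f(k), −m_crit(k) + a_kM/Z_k]}`. -/
noncomputable def bandRatio (reg : QCDRegularisation Nf) (k S : ℕ) (m : Fin Nf → ℝ) (f : Fin Nf)
    (M : ℝ) : ℝ :=
  (∫ U, (Multiset.countP (fun z : ℂ => z.im = 0 ∧ -(reg.mcrit k + reg.a k * m f / reg.Zm k) ≤ z.re ∧ z.re ≤ -(reg.mcrit k - reg.a k * M / reg.Zm k)) (wilsonDirac (fundamentalRep (Fin 3)) U 0 1).charpoly.roots : ℝ) * ∏ f : Fin Nf, ‖fermionDet (wilsonDirac (fundamentalRep (Fin 3)) U (reg.mcrit k + reg.a k * m f / reg.Zm k) 1)‖ ∂(wilsonMeasure (d := 4) (L := 2 * S + 1) (fundamentalRep (Fin 3)) (reg.β k))) / (∫ U, ∏ f : Fin Nf, ‖fermionDet (wilsonDirac (fundamentalRep (Fin 3)) U (reg.mcrit k + reg.a k * m f / reg.Zm k) 1)‖ ∂(wilsonMeasure (d := 4) (L := 2 * S + 1) (fundamentalRep (Fin 3)) (reg.β k)))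

/-- The phase-quenched mean of the UNITARY SHELL count of flavour `f`:
`E₊ #{λ(Γ₅D_W(U, m_f(k), 1)) : c·a_k m_f/Z_k ≤ |λ| ≤ a_k(m_f+M)/Z_k}` (card `weyl-transport-unitary-pin`'s
`shellCount`, verbatim predicate). -/
noncomputable def shellRatio (reg : QCDRegularisation Nf) (c : ℝ) (k S : ℕ) (m : Fin Nf → ℝ) (f : Fin Nf)
    (M : ℝ) : ℝ :=
  (∫ U, (Multiset.countP (fun z : ℂ => c * (reg.a k * m f / reg.Zm k) ≤ |z.re| ∧ |z.re| ≤ reg.a k * m f / reg.Zm k + reg.a k * M / reg.Zm k) (spinorLift gammaFive * wilsonDirac (fundamentalRep (Fin 3)) U (reg.mcrit k + reg.a k * m f / reg.Zm k) 1).charpoly.roots : ℝ) * ∏ f : Fin Nf, ‖fermionDet (wilsonDirac (fundamentalRep (Fin 3)) U (reg.mcrit k + reg.a k * m f / reg.Zm k) 1)‖ ∂(wilsonMeasure (d := 4) (L := 2 * S + 1) (fundamentalRep (Fin 3)) (reg.β k))) / (∫ U, ∏ f : Fin Nf, ‖fermionDet (wilsonDirac (fundamentalRep (Fin 3)) U (reg.mcrit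 k + reg.a k * m f / reg.Zm k) 1)‖ ∂(wilsonMeasure (d := 4) (L := 2 * S + 1) (fundamentalRep (Fin 3)) (reg.β k)))

/-- **TIGHT ≤ WINDOW + EXTINCT (ratios).** -/
theorem tightRatio_le_windowRatio_add_extinctRatio (reg : QCDRegularisation Nf) (c : ℝ) (k S : ℕ)
    {m : Fin Nf → ℝ} {M : ℝ} (f₀ : Fin Nf) (hm : 0 ≤ m f₀) (hM : 0 ≤ M) :
    tightRatio reg k S m M ≤ windowRatio reg k S m f₀ M + extinctRatio reg c k S m := by
  unfold tightRatio windowRatio extinctRatio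
  rw [← add_div, ← integral_add]
  · refine div_le_div_of_nonneg_right ?_
      (integral_nonneg fun U => Finset.prod_nonneg fun f _ => norm_nonneg _)
    refine integral_mono_of_nonneg (Eventually.of_forall fun U => ?_) ?_ (Eventually.of_forall fun U => ?_)
    · exact mul_nonneg (abs_nonneg _) (Finset.prod_nonneg fun f _ => norm_nonneg _)
    · exact (integrable_natCount_mul_weight _ _ (measurable_windowCount _ _)
        (fun U => countP_roots_charpoly_le_card _ _)).add
        (integrable_extinctIntegrand reg c k m (reg.β k))
    · exact tightIntegrand_mul_le_window_add_extinct_mul U reg c k m M f₀ hm hM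
  · exact integrable_natCount_mul_weight _ _ (measurable_windowCount _ _)
        (fun U => countP_roots_charpoly_le_card _ _)
  · exact integrable_extinctIntegrand reg c k m (reg.β k)

/-- **TIGHT ≤ BAND + EXTINCT (ratios).** -/
theorem tightRatio_le_bandRatio_add_extinctRatio (reg : QCDRegularisation Nf) (c : ℝ) (k S : ℕ)
    {m : Fin Nf → ℝ} {M : ℝ} (f₀ : Fin Nf) (hm : 0 ≤ m f₀) (hM : 0 ≤ M) :
    tightRatio reg k S m M ≤ bandRatio reg k S m f₀ M + extinctRatio reg c k S m := by
  unfold tightRatio bandRatio extinctRatio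
  rw [← add_div, ← integral_add]
  · refine div_le_div_of_nonneg_right ?_
      (integral_nonneg fun U => Finset.prod_nonneg fun f _ => norm_nonneg _)
    refine integral_mono_of_nonneg (Eventually.of_forall fun U => ?_) ?_ (Eventually.of_forall fun U => ?_)
    · exact mul_nonneg (abs_nonneg _) (Finset.prod_nonneg fun f _ => norm_nonneg _)
    · exact (integrable_natCount_mul_weight _ _ (measurable_bandCount _ _)
        (fun U => countP_roots_charpoly_le_card _ _)).add
        (integrable_extinctIntegrand reg c k m (reg.β k))
    · exact tightIntegrand_mul_le_band_add_extinct_mul U reg c k m M f₀ hm hM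
  · exact integrable_natCount_mul_weight _ _ (measurable_bandCount _ _)
        (fun U => countP_roots_charpoly_le_card _ _)
  · exact integrable_extinctIntegrand reg c k m (reg.β k)

/-- **TIGHT ≤ SHELL + EXTINCT (ratios).** -/
theorem tightRatio_le_shellRatio_add_extinctRatio (reg : QCDRegularisation Nf) (c : ℝ) (k S : ℕ)
    {m : Fin Nf → ℝ} {M : ℝ} (f₀ : Fin Nf) (hm : 0 ≤ m f₀) (hM : 0 ≤ M) :
    tightRatio reg k S m M ≤ shellRatio reg c k S m f₀ M + extinctRatio reg c k S m := by
  unfold tightRatio shellRatio extinctRatio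
  rw [← add_div, ← integral_add]
  · refine div_le_div_of_nonneg_right ?_
      (integral_nonneg fun U => Finset.prod_nonneg fun f _ => norm_nonneg _)
    refine integral_mono_of_nonneg (Eventually.of_forall fun U => ?_) ?_ (Eventually.of_forall fun U => ?_)
    · exact mul_nonneg (abs_nonneg _) (Finset.prod_nonneg fun f _ => norm_nonneg _)
    · exact (integrable_natCount_mul_weight _ _ (measurable_shellCount _ _ _)
        (fun U => countP_roots_charpoly_le_card _ _)).add
        (integrable_extinctIntegrand reg c k m (reg.β k))
    · exact tightIntegrand_mul_le_shell_add_extinct_mul U reg c k m M f₀ hm hM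
  · exact integrable_natCount_mul_weight _ _ (measurable_shellCount _ _ _)
        (fun U => countP_roots_charpoly_le_card _ _)
  · exact integrable_extinctIntegrand reg c k m (reg.β k)

/-- **THE TWO-SIDED PIN, Hermitian currency (what TIGHT ∧ EXTINCT deliver to a bridge prover).** For
witness data `(reg, M₀, c)` EXTINCT and TIGHT at a tuple `m` above `M₀ ≥ 0`, every flavour `f`, every probe
parameter `M > M₀` and every `ε > 0`: eventually in `k`, on the scheme torus, the phase-quenched mean of
`#{eigenvalues λ of Γ₅D_W(U, m_f(k), 1) with |λ| ≤ a_k(m_f + M)/Z_k}` is `≥ 1 − ε` — while EXTINCT(b) makes the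
mean of `#{|λ| < c·a_k m_f/Z_k}` `≤ ε`. The Hermitian Wilson operator AT THE FLAVOUR MASS has, on average,
a near-zero mode at scale exactly `a_k m_f/Z_k` (up to the factor `[c, 1 + M₀/m_f]`): the line is critical. -/
theorem eventually_windowRatio_ge (reg : QCDRegularisation Nf) {M₀ c : ℝ} (hM₀ : 0 ≤ M₀) {m : Fin Nf → ℝ}
    (hm : ∀ f, M₀ < m f) (h : Extinct Nf reg c m ∧ Tight Nf reg M₀ m) (f : Fin Nf) {M : ℝ} (hM : M₀ < M)
    {ε : ℝ} (hε : 0 < ε) :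
    ∀ᶠ k : ℕ in Filter.atTop, 1 - ε ≤ windowRatio reg k (reg.L k) m f M := by
  filter_upwards [h.1 ε hε, h.2 M hM] with k hE hT
  have hT' : 1 ≤ tightRatio reg k (reg.L k) m M := hT
  have hE' : extinctRatio reg c k (reg.L k) m ≤ ε * ((2 * (reg.L k : ℕ) + 1 : ℝ) / (2 * reg.L k + 1)) ^ 4 :=
    hE (reg.L k) le_rfl
  have hone : ((2 * (reg.L k : ℕ) + 1 : ℝ) / (2 * reg.L k + 1)) = 1 := div_self (by positivity)
  rw [hone, one_pow, mul_one] at hE'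
  have := tightRatio_le_windowRatio_add_extinctRatio reg c k (reg.L k) (m := m) (M := M) f
    (by linarith [hm f]) (by linarith)
  linarith

/-- **THE TWO-SIDED PIN, real-mode currency.** Same hypotheses: eventually in `k`, on the scheme torus, the
phase-quenched mean of `#{real eigenvalues of D_W(U,0,1) in [−m_f(k), −m_crit(k) + a_kM/Z_k]}` is `≥ 1 − ε`
(a real-mode accumulation edge at `−m_crit(k)`, sharp to `a_k(m_f+M)/Z_k`; EXTINCT(a) empties everything
below `−m_f(k)`). This is the content of card `tight-two-sided-pin`, now a theorem about the hypothesis. -/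
theorem eventually_bandRatio_ge (reg : QCDRegularisation Nf) {M₀ c : ℝ} (hM₀ : 0 ≤ M₀) {m : Fin Nf → ℝ}
    (hm : ∀ f, M₀ < m f) (h : Extinct Nf reg c m ∧ Tight Nf reg M₀ m) (f : Fin Nf) {M : ℝ} (hM : M₀ < M)
    {ε : ℝ} (hε : 0 < ε) :
    ∀ᶠ k : ℕ in Filter.atTop, 1 - ε ≤ bandRatio reg k (reg.L k) m f M := by
  filter_upwards [h.1 ε hε, h.2 M hM] with k hE hT
  have hT' : 1 ≤ tightRatio reg k (reg.L k) m M := hT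
  have hE' : extinctRatio reg c k (reg.L k) m ≤ ε * ((2 * (reg.L k : ℕ) + 1 : ℝ) / (2 * reg.L k + 1)) ^ 4 :=
    hE (reg.L k) le_rfl
  have hone : ((2 * (reg.L k : ℕ) + 1 : ℝ) / (2 * reg.L k + 1)) = 1 := div_self (by positivity)
  rw [hone, one_pow, mul_one] at hE'
  have := tightRatio_le_bandRatio_add_extinctRatio reg c k (reg.L k) (m := m) (M := M) f
    (by linarith [hm f]) (by linarith)
  linarith

/-- **THE SEA-SHELL PIN (unitary currency; card `weyl-transport-unitary-pin`'s stub `seaShellPin`, proved in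
a STRONGER form: bound `1 − ε` instead of `1 − 2ε`, no `hline`/`0 < c` hypotheses).** For witness data
`(reg, M₀, c)` EXTINCT and TIGHT at a tuple `m` above `M₀ ≥ 0`, every flavour `f`, every `M > M₀` and every `ε > 0`:
eventually in `k`, on the scheme torus, the phase-quenched mean of
`#{eigenvalues λ of Γ₅D_W(U, m_f(k), 1) with c·a_k m_f/Z_k ≤ |λ| ≤ a_k(m_f+M)/Z_k}` is `≥ 1 − ε`: the Hermitian
Wilson operator AT THE UNITARY POINT (valence mass = sea mass) has, on average, a mode in the running-mass
shell — lightness at the unitary point, the certificate the card's non-decoupling transfer consumes. -/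
theorem eventually_shellRatio_ge (reg : QCDRegularisation Nf) {M₀ c : ℝ} (hM₀ : 0 ≤ M₀) {m : Fin Nf → ℝ}
    (hm : ∀ f, M₀ < m f) (h : Extinct Nf reg c m ∧ Tight Nf reg M₀ m) (f : Fin Nf) {M : ℝ} (hM : M₀ < M)
    {ε : ℝ} (hε : 0 < ε) :
    ∀ᶠ k : ℕ in Filter.atTop, 1 - ε ≤ shellRatio reg c k (reg.L k) m f M := by
  filter_upwards [h.1 ε hε, h.2 M hM] with k hE hT
  have hT' : 1 ≤ tightRatio reg k (reg.L k) m M := hT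
  have hE' : extinctRatio reg c k (reg.L k) m ≤ ε * ((2 * (reg.L k : ℕ) + 1 : ℝ) / (2 * reg.L k + 1)) ^ 4 :=
    hE (reg.L k) le_rfl
  have hone : ((2 * (reg.L k : ℕ) + 1 : ℝ) / (2 * reg.L k + 1)) = 1 := div_self (by positivity)
  rw [hone, one_pow, mul_one] at hE'
  have := tightRatio_le_shellRatio_add_extinctRatio reg c k (reg.L k) (m := m) (M := M) f
    (by linarith [hm f]) (by linarith)
  linarith

/-- The card's stub `seaShellPin` verbatim (route objects, its own constant `1 − 2ε`), as a COROLLARY — its extra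
hypotheses (`0 < c`, the line eventually negative) are not needed. -/
theorem seaShellPin {Nf : ℕ} (reg : QCDRegularisation Nf) (M₀ c : ℝ) (m : Fin Nf → ℝ) (hm : ∀ f, M₀ < m f)
    (hM₀ : 0 ≤ M₀) (hE : Extinct Nf reg c m) (hT : Tight Nf reg M₀ m) (f : Fin Nf) (M : ℝ) (hM : M₀ < M)
    (ε : ℝ) (hε : 0 < ε) :
    ∀ᶠ k : ℕ in atTop, 1 - 2 * ε ≤
      (∫ U, (Multiset.countP (fun z : ℂ => c * (reg.a k * m f / reg.Zm k) ≤ |z.re| ∧ |z.re| ≤ reg.a k * m f / reg.Zm k + reg.a k * M / reg.Zm k) (spinorLift gammaFive * wilsonDirac (fundamentalRep (Fin 3)) U (reg.mcrit k + reg.a k * m f / reg.Zm k) 1).charpoly.roots : ℝ) *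
          ∏ g : Fin Nf, ‖fermionDet (wilsonDirac (fundamentalRep (Fin 3)) U
            (reg.mcrit k + reg.a k * m g / reg.Zm k) 1)‖
        ∂(wilsonMeasure (d := 4) (L := 2 * reg.L k + 1) (fundamentalRep (Fin 3)) (reg.β k))) /
      (∫ U, ∏ g : Fin Nf, ‖fermionDet (wilsonDirac (fundamentalRep (Fin 3)) U
            (reg.mcrit k + reg.a k * m g / reg.Zm k) 1)‖
        ∂(wilsonMeasure (d := 4) (L := 2 * reg.L k + 1) (fundamentalRep (Fin 3)) (reg.β k))) := by
  filter_upwards [eventually_shellRatio_ge reg hM₀ hm ⟨hE, hT⟩ f hM hε] with k hk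
  have hk' : 1 - ε ≤ shellRatio reg c k (reg.L k) m f M := hk
  have : 1 - 2 * ε ≤ shellRatio reg c k (reg.L k) m f M := by linarith
  exact this

/-- **Reading for the sibling crux.** Any witness `(reg, M₀, c)` of `SD(N_f)` delivers, for every tuple above
`M₀`, every flavour, every `M > M₀` and `ε > 0`, eventually in `k`: window mean `≥ 1 − ε` AND band mean
`≥ 1 − ε` on the scheme torus — the two-sided pin in both currencies — and has `c ≤ 1`. -/
theorem SDHyp.two_sided_pin (h : SDHyp Nf) :
    ∃ reg : QCDRegularisation Nf, ∃ M₀ : ℝ, 0 ≤ M₀ ∧ ∃ c : ℝ, 0 < c ∧ c ≤ 1 ∧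
      ∀ m : Fin Nf → ℝ, (∀ f, M₀ < m f) → ∀ f : Fin Nf, ∀ M : ℝ, M₀ < M → ∀ ε : ℝ, 0 < ε →
        ∀ᶠ k : ℕ in Filter.atTop, 1 - ε ≤ windowRatio reg k (reg.L k) m f M ∧
          1 - ε ≤ bandRatio reg k (reg.L k) m f M ∧ 1 - ε ≤ shellRatio reg c k (reg.L k) m f M := by
  obtain ⟨reg, -, -, M₀, hM₀, c, hc, h⟩ := h
  rcases Nat.eq_zero_or_pos Nf with hNf | hNf
  · subst hNf
    exact ⟨reg, M₀, hM₀, min c 1, lt_min hc one_pos, min_le_right _ _,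
      fun m hm f => f.elim0⟩
  · exact ⟨reg, M₀, hM₀, c, hc, SDHyp.c_le_one hNf hM₀ h, fun m hm f M hM ε hε =>
      (eventually_windowRatio_ge reg hM₀ hm (h m hm) f hM hε).and
        ((eventually_bandRatio_ge reg hM₀ hm (h m hm) f hM hε).and
          (eventually_shellRatio_ge reg hM₀ hm (h m hm) f hM hε))⟩

end Pin

end Summit.QuantumFields.QCD.Theorems.ExtinctionBuildsQCD.Negative

end
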